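import Mathlib
import Summits.KontsevichZagierPeriods.Zeta5Search.WedgePencilDInterface
import Summits.KontsevichZagierPeriods.Zeta5Search.QTwoTermBoundaryWide
import HarnessLib

/-!
# The `d`-interface PENCIL law for Brown–Zudilin's leading coefficient `Q` (cell `pub-zeta5`, ct-1 g24)

HONEST FRAMING: systematic search; no irrationality claim unless certified.  Identities among Brown–Zudilin's leading coefficient
`Q(a)` ([BrownZudilin2022, (17)], `QOf`) at neighbouring parameter vectors and the cell's rational dictionary data (`U`, `W`, the
proved gauge `ρ`); no integral is evaluated, nothing about sizes, denominators or ζ(5); records in print UNMOVED.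

OUR work (Summit side; seat `pub-zeta5-ct-1` generation 24, 2026-08-26).  gen-1's PENCIL relation in slot `i` has the members
`a` (base, coefficient `pencilBase(c) = −(c₂+1)(c₃+1)`, `c = b(a)`), `a + DS` (apex, `pencilApex(c, i) = (c_i+1)(c₀+2−c_i)`) and
`a + DS − s_i` (`fanCoeff(b(a + DS), i)`).  ACROSS THE `d`-BOUNDARY — `d(c) = 0`, so `d(b(a + DS)) = −1` and `Q(a + DS) = 0`
(ct-1 g24's `QOf_eq_zero_of_dOf_neg`) — the relation for `Q` is the two-term law
`(c₂+1)(c₃+1)·Q(a) = fanCoeff(c⁺, i)·Q(a + DS − s_i)`, proved here from ct-1 g24's wedge form `lawD_wedge`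
(`WedgePencilDInterface`) for the slot-free wedge `casUW` (`wedge_slot_free`), dressed with the dictionary `Q = ρ·casUW`
(ct-1 g22's `dict_values_wide`, at `a` and at `a + DS − s_i`), the gauge `rhoB_dZero_gauge` and the two per-slot identities;
when a (necessarily non-edge) pair through `i` exceeds the level, `Q(a) = 0` and either `Q(a + DS − s_i) = 0` or the fan
coefficient vanishes.

* `bOfA_dsUp_slotDown`, `converges_dsUp`, `converges_dsUp_slotDown`, `dOf_bOfA_add_dsUp` — bookkeeping for the members
  `a + DS`, `a + DS − s_i` (they converge as soon as `a` does);
* `pair_edge_or_nonEdge`, `nonEdge_partner_mem`, `nonEdge_of_pair_gt`, `QOf_eq_zero_of_pair_gt` — on the convergence cone a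
  pair of slots exceeding the level is non-edge, so `Q = 0` there (gen-1 g4's `QOf_eq_zero_of_nonEpair`);
* `inBox_update_sub_one`, `dOf_update_sub_one` — the lowered point `x = c − e_i`;
* **`dictPencil_Q_dZero`** — for a convergent `a` with `b(a) = c ≥ 0`, `d(c) = 0`, a slot `i ∈ [1,7]` with `c_i ≥ 1`:
  `pencilBase(c)·Q(a) + pencilApex(c, i)·Q(a + DS) + fanCoeff(b(a + DS), i)·Q(a + DS − s_i) = 0`; exact check before
  formalisation (seat folder `code/laws.py`, slot 2, levels `≤ 5`): 553/553 instances, 301 of them with `Q(a) ≠ 0`.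
Use (ct-1 g24): the `Q`-side of the apex PENCIL steps (points with `d(b) = −1`) in the proof of Brown–Zudilin's decomposition (4)
on the whole convergence cone; together with ct-1 g24's `dictPencil_Q_of_ghost_base` (`QTwoTermBoundaryWide`, the base steps)
and `QOf_eq_zero_off_wide` these are all the `Q`-relations that induction needs (seat folder `code/scheme5.py`: the `Q`-side of
every step at all 34 919 non-wide convergent dual points of the box `{0,…,4}⁸`, 0 failures).
-/

noncomputable section

open Finset

namespace Summit.KontsevichZagierPeriods.Zeta5Search.WedgeDictionary

open Summit.KontsevichZagierPeriods.Zeta5Search.DualSeries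
open Summit.KontsevichZagierPeriods.Zeta5Search.SymmetricGauge (permLower rhoB rhoOf_eq_rhoB)
open Summit.KontsevichZagierPeriods.Zeta5Search.Elimination (permLower_swap6_apply edgeProd dsShift_apply dOf_dsShift
  fanCoeff_congr cas_congr rhoB_congr)
open Summit.KontsevichZagierPeriods.Zeta5Search.WedgeDictionaryDictStarWide (dict_values_wide)
open Literature.NumberTheory.Irrationality.BrownZudilin2022 (bOfA Converges QOf)

/-! ### 1. The members `a + DS`, `a + DS − s_i` -/

/-- `b(a + DS − s_i)` in terms of `c = b(a)`: level `N + 2`, slot `i` equal to `c_i`, the other slots `c_n + 1`. -/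
theorem bOfA_dsUp_slotDown (a : Fin 8 → ℤ) {i : ℕ} (hi : i ∈ Icc 1 7) (n : ℕ) (hn : n ≤ 7) :
    bOfA (a + dsUp + slotDown i) n =
      if n = 0 then bOfA a 0 + 2 else if n = i then bOfA a i else bOfA a n + 1 := by
  obtain ⟨hi1, hi7⟩ := mem_Icc.1 hi
  rw [bOfA_add_slotDown (a + dsUp) i hi n hn, bOfA_add_dsUp a n hn]
  by_cases hni : n = i
  · subst hni
    rw [if_pos rfl, if_neg (by omega), if_neg (by omega), if_pos rfl]
    ring
  · rw [if_neg hni]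
    by_cases h0 : n = 0
    · rw [if_pos h0, if_pos h0]
    · rw [if_neg h0, if_neg h0, if_neg hni]

/-- The apex `a + DS` converges as soon as `a` does. -/
theorem converges_dsUp {a : Fin 8 → ℤ} (hconv : Converges a) : Converges (a + dsUp) := by
  have hc := (WedgeDictionaryWideSteps.converges_iff_bcoords a).1 hconv
  have eD : ∀ n, n ≤ 7 → bOfA (a + dsUp) n = if n = 0 then bOfA a 0 + 2 else bOfA a n + 1 :=
    fun n hn => bOfA_add_dsUp a n hn
  have e0 := eD 0 (by norm_num); have e1 := eD 1 (by norm_num); have e2 := eD 2 (by norm_num)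
  have e3 := eD 3 (by norm_num); have e4 := eD 4 (by norm_num); have e5 := eD 5 (by norm_num)
  have e6 := eD 6 (by norm_num); have e7 := eD 7 (by norm_num)
  simp only [↓reduceIte, show (1:ℕ) ≠ 0 from by norm_num, show (2:ℕ) ≠ 0 from by norm_num, show (3:ℕ) ≠ 0 from by norm_num,
    show (4:ℕ) ≠ 0 from by norm_num, show (5:ℕ) ≠ 0 from by norm_num, show (6:ℕ) ≠ 0 from by norm_num,
    show (7:ℕ) ≠ 0 from by norm_num] at e0 e1 e2 e3 e4 e5 e6 e7
  rw [WedgeDictionaryWideSteps.converges_iff_bcoords, e0, e1, e2, e3, e4, e5, e6, e7]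
  omega

/-- The lowered apex `a + DS − s_i` converges as soon as `a` does (`i ∈ [1,7]`). -/
theorem converges_dsUp_slotDown {a : Fin 8 → ℤ} (hconv : Converges a) {i : ℕ} (hi : i ∈ Icc 1 7) :
    Converges (a + dsUp + slotDown i) := by
  obtain ⟨hi1, hi7⟩ := mem_Icc.1 hi
  have hc := (WedgeDictionaryWideSteps.converges_iff_bcoords a).1 hconv
  have eS := bOfA_dsUp_slotDown a hi
  have e0 := eS 0 (by norm_num); have e1 := eS 1 (by norm_num); have e2 := eS 2 (by norm_num)
  have e3 := eS 3 (by norm_num); have e4 := eS 4 (by norm_num); have e5 := eS 5 (by norm_num)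
  have e6 := eS 6 (by norm_num); have e7 := eS 7 (by norm_num)
  rw [WedgeDictionaryWideSteps.converges_iff_bcoords, e0, e1, e2, e3, e4, e5, e6, e7]
  interval_cases i <;> simp only [↓reduceIte, show (1:ℕ) ≠ 0 from by norm_num,
    show (2:ℕ) ≠ 0 from by norm_num, show (3:ℕ) ≠ 0 from by norm_num, show (4:ℕ) ≠ 0 from by norm_num,
    show (5:ℕ) ≠ 0 from by norm_num, show (6:ℕ) ≠ 0 from by norm_num, show (7:ℕ) ≠ 0 from by norm_num,
    show (1:ℕ) ≠ 2 from by norm_num, show (1:ℕ) ≠ 3 from by norm_num, show (1:ℕ) ≠ 4 from by norm_num,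
    show (1:ℕ) ≠ 5 from by norm_num, show (1:ℕ) ≠ 6 from by norm_num, show (1:ℕ) ≠ 7 from by norm_num,
    show (2:ℕ) ≠ 1 from by norm_num, show (2:ℕ) ≠ 3 from by norm_num, show (2:ℕ) ≠ 4 from by norm_num,
    show (2:ℕ) ≠ 5 from by norm_num, show (2:ℕ) ≠ 6 from by norm_num, show (2:ℕ) ≠ 7 from by norm_num,
    show (3:ℕ) ≠ 1 from by norm_num, show (3:ℕ) ≠ 2 from by norm_num, show (3:ℕ) ≠ 4 from by norm_num,
    show (3:ℕ) ≠ 5 from by norm_num, show (3:ℕ) ≠ 6 from by norm_num, show (3:ℕ) ≠ 7 from by norm_num,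
    show (4:ℕ) ≠ 1 from by norm_num, show (4:ℕ) ≠ 2 from by norm_num, show (4:ℕ) ≠ 3 from by norm_num,
    show (4:ℕ) ≠ 5 from by norm_num, show (4:ℕ) ≠ 6 from by norm_num, show (4:ℕ) ≠ 7 from by norm_num,
    show (5:ℕ) ≠ 1 from by norm_num, show (5:ℕ) ≠ 2 from by norm_num, show (5:ℕ) ≠ 3 from by norm_num,
    show (5:ℕ) ≠ 4 from by norm_num, show (5:ℕ) ≠ 6 from by norm_num, show (5:ℕ) ≠ 7 from by norm_num,
    show (6:ℕ) ≠ 1 from by norm_num, show (6:ℕ) ≠ 2 from by norm_num, show (6:ℕ) ≠ 3 from by norm_num,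
    show (6:ℕ) ≠ 4 from by norm_num, show (6:ℕ) ≠ 5 from by norm_num, show (6:ℕ) ≠ 7 from by norm_num,
    show (7:ℕ) ≠ 1 from by norm_num, show (7:ℕ) ≠ 2 from by norm_num, show (7:ℕ) ≠ 3 from by norm_num,
    show (7:ℕ) ≠ 4 from by norm_num, show (7:ℕ) ≠ 5 from by norm_num, show (7:ℕ) ≠ 6 from by norm_num] <;> omega

/-! ### 2. Pairs exceeding the level; the lowered point; the law -/

/-- `d(b(a + DS)) = d(b(a)) − 1`. -/
theorem dOf_bOfA_add_dsUp (a : Fin 8 → ℤ) : dOf (bOfA (a + dsUp)) = dOf (bOfA a) - 1 := by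
  rw [dOf_bOfA, dOf_bOfA]
  simp [dsUp]
  ring

/-- Two distinct slots of `[1,7]` form an edge pair or a non-edge pair (in one of the two orders). -/
theorem pair_edge_or_nonEdge : ∀ j ∈ Icc 1 7, ∀ m ∈ Icc 1 7, j ≠ m →
    ((j, m) ∈ Epairs ∨ (m, j) ∈ Epairs) ∨ ((j, m) ∈ nonEpairs ∨ (m, j) ∈ nonEpairs) := by
  decide

/-- The table `nonEdgePartners` lists both orders of every non-edge pair. -/
theorem nonEdge_partner_mem : ∀ j ∈ Icc 1 7, ∀ m ∈ Icc 1 7,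
    ((j, m) ∈ nonEpairs ∨ (m, j) ∈ nonEpairs) → m ∈ nonEdgePartners j := by
  decide

/-- On the convergence cone two distinct slots whose sum exceeds the level form a NON-edge pair
(`epairs_le_of_converges`). -/
theorem nonEdge_of_pair_gt (a : Fin 8 → ℤ) (hconv : Converges a) {j m : ℕ} (hj : j ∈ Icc 1 7) (hm : m ∈ Icc 1 7)
    (hjm : j ≠ m) (hgt : bOfA a 0 < bOfA a j + bOfA a m) : (j, m) ∈ nonEpairs ∨ (m, j) ∈ nonEpairs := by
  have hE := epairs_le_of_converges a hconv
  rcases pair_edge_or_nonEdge j hj m hm hjm with (h | h) | h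
  · have h' := hE _ h; dsimp only at h'; omega
  · have h' := hE _ h; dsimp only at h'; omega
  · exact h

/-- On the convergence cone a pair of distinct slots whose sum exceeds the level kills `Q` (gen-1 g4's
`QOf_eq_zero_of_nonEpair`, the pair being non-edge by `nonEdge_of_pair_gt`). -/
theorem QOf_eq_zero_of_pair_gt (a : Fin 8 → ℤ) (hconv : Converges a) {j m : ℕ} (hj : j ∈ Icc 1 7) (hm : m ∈ Icc 1 7)
    (hjm : j ≠ m) (hgt : bOfA a 0 < bOfA a j + bOfA a m) : QOf a = 0 := by
  rcases nonEdge_of_pair_gt a hconv hj hm hjm hgt with h | h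
  · exact QOf_eq_zero_of_nonEpair a hconv ⟨_, h, hgt⟩
  · exact QOf_eq_zero_of_nonEpair a hconv ⟨_, h, by dsimp only; omega⟩

/-- Lowering the slot `s+1` (`s < 7`) of a box point with `c_{s+1} ≥ 1` stays in the box. -/
theorem inBox_update_sub_one (c : ℕ → ℤ) (hc : InBox c) {s : ℕ} (hs : s < 7) (h1 : 1 ≤ c (s + 1)) :
    InBox (Function.update c (s + 1) (c (s + 1) - 1)) := by
  refine ⟨by rw [Function.update_of_ne (by omega)]; exact hc.1, fun j hj => ?_⟩
  rw [Function.update_of_ne (show (0 : ℕ) ≠ s + 1 by omega)]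
  by_cases h : j + 1 = s + 1
  · rw [h, Function.update_self]; have := hc.2 s (mem_range.2 hs); omega
  · rw [Function.update_of_ne h]; exact hc.2 j hj

/-- Lowering the slot `s+1` (`s < 7`) raises `d` by one. -/
theorem dOf_update_sub_one (c : ℕ → ℤ) {s : ℕ} (hs : s < 7) :
    dOf (Function.update c (s + 1) (c (s + 1) - 1)) = dOf c + 1 := by
  have e : ∀ j ∈ range 7, Function.update c (s + 1) (c (s + 1) - 1) (j + 1) =
      c (j + 1) + (if j = s then -1 else 0) := fun j _ => by
    by_cases h : j = s
    · rw [if_pos h, h, Function.update_self]; ring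
    · rw [if_neg h, Function.update_of_ne (show j + 1 ≠ s + 1 by omega)]; ring
  unfold dOf
  rw [sum_congr rfl e, sum_add_distrib, sum_ite_eq' (range 7) s (fun _ => (-1 : ℤ)), if_pos (mem_range.2 hs),
    Function.update_of_ne (show (0 : ℕ) ≠ s + 1 by omega)]
  ring

set_option maxHeartbeats 800000 in
/-- **THE `d`-INTERFACE PENCIL LAW FOR `Q`.**  For a convergent `a` with `c = b(a) ≥ 0`, `d(c) = 0` and a slot `i ∈ [1,7]`
with `c_i ≥ 1`, gen-1's PENCIL relation in slot `i` for `Q`, based at `a`, holds: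
`pencilBase(c)·Q(a) + pencilApex(c, i)·Q(a + DS) + fanCoeff(b(a + DS), i)·Q(a + DS − s_i) = 0`.
Across the `d`-boundary the apex has `d = −1`, so `Q(a + DS) = 0` (`QOf_eq_zero_of_dOf_neg`) and the law is the two-term
identity `(c₂+1)(c₃+1)·Q(a) = fanCoeff(c⁺, i)·Q(a + DS − s_i)`.  Proof: if some pair through `i` exceeds the level, all
three `Q` vanish (`QOf_eq_zero_of_pair_gt`); otherwise `R ≠ 0` and the law is `lawD_wedge` (for the slot-free wedge
`casUW`, `wedge_slot_free`) dressed with the dictionary `Q = ρ·casUW` (ct-1 g22's `dict_values_wide` at `a` and at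
`a + DS − s_i`), the gauge `rhoB_dZero_gauge` and the two per-slot identities. -/
theorem dictPencil_Q_dZero (a : Fin 8 → ℤ) {i : ℕ} (hconv : Converges a) (hnn : ∀ n ∈ Icc 1 7, 0 ≤ bOfA a n)
    (hd0 : dOf (bOfA a) = 0) (hi : i ∈ Icc 1 7) (hi1 : 1 ≤ bOfA a i) :
    (pencilBase (bOfA a) : ℚ) * (QOf a : ℚ) + (pencilApex (bOfA a) i : ℚ) * (QOf (a + dsUp) : ℚ) +
      (fanCoeff (bOfA (a + dsUp)) i : ℚ) * (QOf (a + dsUp + slotDown i) : ℚ) = 0 := by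
  obtain ⟨hi1', hi7⟩ := mem_Icc.1 hi
  -- the apex term vanishes: `d(b(a + DS)) = −1`
  have hapex : QOf (a + dsUp) = 0 := QOf_eq_zero_of_dOf_neg _ (by rw [dOf_bOfA_add_dsUp, hd0]; norm_num)
  rw [hapex, Int.cast_zero, mul_zero, add_zero]
  -- the third member `a' = a + DS − s_i`: convergent, coordinates `(N+2; c_n + 1 (n ≠ i), c_i)`, `d = 0`
  have hconv' : Converges (a + dsUp + slotDown i) := converges_dsUp_slotDown hconv hi
  have hco' := bOfA_dsUp_slotDown a hi
  have hd' : 0 ≤ dOf (bOfA (a + dsUp + slotDown i)) := by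
    rw [dOf_bOfA_slotDown _ hi, dOf_bOfA_add_dsUp, hd0]; norm_num
  have hnn' : ∀ n ∈ Icc 1 7, 0 ≤ bOfA (a + dsUp + slotDown i) n := fun n hn => by
    obtain ⟨hn1, hn7⟩ := mem_Icc.1 hn
    rw [hco' n hn7, if_neg (by omega)]
    by_cases hni : n = i
    · rw [if_pos hni]; omega
    · rw [if_neg hni]; have := hnn n hn; omega
  -- (0) the degenerate case: a (non-edge) pair `(i, m)` exceeds the level — `Q(a) = 0`, and either the pair still
  -- exceeds at `a'` (`Q(a') = 0`) or `c_i + c_m = N + 1` exactly and the fan coefficient has the factor `N + 1 − c_i − c_m = 0`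
  by_cases hdeg : ∃ m ∈ Icc 1 7, m ≠ i ∧ bOfA a 0 < bOfA a i + bOfA a m
  · obtain ⟨m, hm, hmi, hgt⟩ := hdeg
    obtain ⟨hm1, hm7⟩ := mem_Icc.1 hm
    have hQ : QOf a = 0 := QOf_eq_zero_of_pair_gt a hconv hi hm (Ne.symm hmi) hgt
    rw [hQ, Int.cast_zero, mul_zero, zero_add]
    rcases lt_or_eq_of_le (show bOfA a 0 + 1 ≤ bOfA a i + bOfA a m by omega) with hlt | heq
    · have e0 : bOfA (a + dsUp + slotDown i) 0 = bOfA a 0 + 2 := by rw [hco' 0 (by norm_num), if_pos rfl]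
      have ei : bOfA (a + dsUp + slotDown i) i = bOfA a i := by
        rw [hco' i hi7, if_neg (show i ≠ 0 by omega), if_pos rfl]
      have em : bOfA (a + dsUp + slotDown i) m = bOfA a m + 1 := by
        rw [hco' m hm7, if_neg (show m ≠ 0 by omega), if_neg hmi]
      have hQ' : QOf (a + dsUp + slotDown i) = 0 :=
        QOf_eq_zero_of_pair_gt _ hconv' hi hm (Ne.symm hmi) (by rw [e0, ei, em]; omega)
      rw [hQ', Int.cast_zero, mul_zero]
    · have hmem : m ∈ nonEdgePartners i :=
        nonEdge_partner_mem i hi m hm (nonEdge_of_pair_gt a hconv hi hm (Ne.symm hmi) hgt)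
      have hfan : fanCoeff (bOfA (a + dsUp)) i = 0 := by
        unfold fanCoeff
        refine mul_eq_zero_of_right _ (List.prod_eq_zero ?_)
        rw [List.mem_map]
        refine ⟨m, hmem, ?_⟩
        rw [bOfA_add_dsUp a 0 (by norm_num), bOfA_add_dsUp a i hi7, bOfA_add_dsUp a m hm7, if_pos rfl,
          if_neg (show i ≠ 0 by omega), if_neg (show m ≠ 0 by omega)]
        omega
      rw [hfan, Int.cast_zero, zero_mul]
  push Not at hdeg
  -- (1) the objects: `c = b(a)`, the slot `i = s+1`, the lowered point `x = c − e_i`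
  obtain ⟨s, rfl⟩ : ∃ s : Fin 7, i = s.val + 1 := ⟨⟨i - 1, by omega⟩, by simp only; omega⟩
  obtain ⟨hbox, hle⟩ := inBox_of_full a hconv hnn
  have hE : ∀ jk ∈ Epairs, bOfA a jk.1 + bOfA a jk.2 ≤ bOfA a 0 := epairs_le_of_converges a hconv
  have hiN : bOfA a (s.val + 1) ≤ bOfA a 0 := hle _ hi
  have h7N : bOfA a 7 ≤ bOfA a 0 := hle 7 (by simp)
  -- the dictionary at `a` and at `a'`
  obtain ⟨hQa, -, -⟩ := dict_values_wide hi hconv hnn (le_of_eq hd0.symm)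
  obtain ⟨hQa', -, -⟩ := dict_values_wide hi hconv' hnn' hd'
  -- the fan coefficient lives on `c⁺ = dsShift c`
  have hF : fanCoeff (bOfA (a + dsUp)) (s.val + 1) = fanCoeff (dsShift (bOfA a)) (s.val + 1) :=
    fanCoeff_congr (fun n hn => by rw [bOfA_add_dsUp a n hn, dsShift_apply]) hi
  -- the gauge and the two per-slot identities (they mention `x = c − e_i` literally)
  have G := rhoB_dZero_gauge (bOfA a) s hbox hd0 hi1 hE
  have Ia := lawD_gauge_identity_base (bOfA a) s
  have Ib := lawD_gauge_identity_fan (bOfA a) s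
  set x : ℕ → ℤ := Function.update (bOfA a) (s.val + 1) (bOfA a (s.val + 1) - 1) with hx
  have x0 : x 0 = bOfA a 0 := by rw [hx]; exact Function.update_of_ne (by omega) _ _
  have xs : x (s.val + 1) = bOfA a (s.val + 1) - 1 := by rw [hx]; exact Function.update_self _ _ _
  have xk : ∀ k, k ≠ s.val + 1 → x k = bOfA a k := fun k hk => by rw [hx]; exact Function.update_of_ne hk _ _
  have hxI : InBox x := inBox_update_sub_one (bOfA a) hbox s.isLt hi1
  have hdx : dOf x = 1 := by rw [hx, dOf_update_sub_one (bOfA a) s.isLt, hd0]; norm_num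
  have hbx : bump x s.val = bOfA a := by
    funext n
    by_cases hn : n = s.val + 1
    · rw [hn, bump_self, xs]; ring
    · rw [bump_of_ne _ hn, xk n hn]
  -- coordinates of `a'` are those of `x⁺ = dsShift x`
  have hco'' : ∀ n, n ≤ 7 → bOfA (a + dsUp + slotDown (s.val + 1)) n = dsShift x n := fun n hn => by
    rw [hco' n hn, dsShift_apply]
    by_cases h0 : n = 0
    · rw [if_pos h0, if_pos h0, x0]
    · rw [if_neg h0, if_neg h0]
      by_cases hni : n = s.val + 1
      · rw [if_pos hni, hni, xs]; ring
      · rw [if_neg hni, xk n hni]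
  rw [rhoOf_eq_rhoB] at hQa
  rw [rhoOf_eq_rhoB, rhoB_congr hco'', (cas_congr hco'').1] at hQa'
  -- (2) `R ≠ 0`: every pair through `i` is `≤ N`
  have hR : (∏ k ∈ range 6, ((x 0 : ℚ) - x (s.val + 1) - permLower (Equiv.swap s 6) x (k + 1))) ≠ 0 := by
    rw [prod_ne_zero_iff]
    intro k hk
    have hk6 := mem_range.1 hk
    have hm : permLower (Equiv.swap s 6) x (k + 1) = if k + 1 = s.val + 1 then bOfA a 7 else bOfA a (k + 1) := by
      rw [permLower_swap6_apply, if_neg (by omega)]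
      split_ifs with h
      · exact xk 7 (by omega)
      · exact xk (k + 1) h
    have hbound : bOfA a (s.val + 1) + permLower (Equiv.swap s 6) x (k + 1) ≤ bOfA a 0 := by
      rw [hm]
      split_ifs with h
      · exact hdeg 7 (by simp) (by omega)
      · exact hdeg (k + 1) (by simp only [mem_Icc]; omega) h
    rw [x0, xs]
    have hq : (((bOfA a (s.val + 1) + permLower (Equiv.swap s 6) x (k + 1) : ℤ) : ℚ)) ≤ ((bOfA a 0 : ℤ) : ℚ) := by
      exact_mod_cast hbound
    push_cast at hq ⊢
    intro h0
    linarith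
  -- (3) the wedge law at `x`, for the slot-free wedge `casUW` at `c` and at `x⁺`
  have W := lawD_wedge x s hxI hdx (by rw [xs, x0]; omega) hR
  rw [hbx] at W
  obtain ⟨fc, -⟩ := wedge_slot_free (bOfA a) hbox (le_of_eq hd0.symm) hi hiN h7N
  have fc' : coeffU (bOfA a) * coeffW (bump (bOfA a) s.val) - coeffU (bump (bOfA a) s.val) * coeffW (bOfA a) =
      casUW (bOfA a) := fc
  have hxpI : InBox (dsShift x) := inBox_dsShift hxI
  have hdxp : 0 ≤ dOf (dsShift x) := by rw [dOf_dsShift, hdx]; norm_num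
  obtain ⟨fxp, -⟩ := wedge_slot_free (dsShift x) hxpI hdxp hi (by rw [dsShift_succ, dsShift_zero, xs, x0]; omega)
    (by
      rw [dsShift_zero, x0]
      by_cases h7 : (7 : ℕ) = s.val + 1
      · rw [h7, dsShift_succ, xs]; omega
      · rw [show (7 : ℕ) = 6 + 1 from rfl, dsShift_succ, xk 7 h7]; omega)
  have fxp' : coeffU (dsShift x) * coeffW (bump (dsShift x) s.val) - coeffU (bump (dsShift x) s.val) * coeffW (dsShift x) =
      casUW (dsShift x) := fxp
  rw [fc', fxp', x0] at W
  -- (4) non-vanishing of `Π·χ`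
  have hxnn : ∀ j, 1 ≤ j → j ≤ 7 → (0 : ℚ) < (x j : ℚ) + 1 := fun j h1 h7 => by
    have h := (hxI.2 (j - 1) (mem_range.2 (by omega))).1
    rw [show j - 1 + 1 = j by omega] at h
    have : (0 : ℚ) ≤ (x j : ℚ) := by exact_mod_cast h
    linarith
  have hPi : (0 : ℚ) < ((([1, 4, 5, 6, 7] : List ℕ).map fun j => ((x j : ℚ) + 1)).prod) := by
    simp only [List.map_cons, List.map_nil, List.prod_cons, List.prod_nil]
    have h1 := hxnn 1 (by norm_num) (by norm_num)
    have h4 := hxnn 4 (by norm_num) (by norm_num)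
    have h5 := hxnn 5 (by norm_num) (by norm_num)
    have h6 := hxnn 6 (by norm_num) (by norm_num)
    have h7 := hxnn 7 (by norm_num) (by norm_num)
    positivity
  have hχ : (0 : ℚ) < (chiOf (bOfA a) (s.val + 1) : ℚ) := by
    have h1 : (1 : ℤ) ≤ chiOf (bOfA a) (s.val + 1) := by
      unfold chiOf
      split_ifs
      · exact hi1
      · exact le_refl _
    have : (1 : ℚ) ≤ (chiOf (bOfA a) (s.val + 1) : ℚ) := by exact_mod_cast h1
    linarith
  -- (5) assemble
  rw [hQa, hQa', hF]
  have key : ((pencilBase (bOfA a) : ℚ) * (rhoB (bOfA a) * casUW (bOfA a)) +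
      (fanCoeff (dsShift (bOfA a)) (s.val + 1) : ℚ) * (rhoB (dsShift x) * casUW (dsShift x))) *
      (((([1, 4, 5, 6, 7] : List ℕ).map fun j => ((x j : ℚ) + 1)).prod) * (chiOf (bOfA a) (s.val + 1) : ℚ)) = 0 := by
    linear_combination (rhoB (bOfA a) * casUW (bOfA a)) * Ia +
      ((fanCoeff (dsShift (bOfA a)) (s.val + 1) : ℚ) * casUW (dsShift x)) * G +
      ((bOfA a (s.val + 1) : ℚ) * rhoB (bOfA a) * casUW (dsShift x)) * Ib -
      ((bOfA a (s.val + 1) : ℚ) * rhoB (bOfA a) * (chiOf (dsShift (bOfA a)) (s.val + 1) : ℚ)) * W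
  exact (mul_eq_zero.1 key).resolve_right (mul_ne_zero (ne_of_gt hPi) (ne_of_gt hχ))

end Summit.KontsevichZagierPeriods.Zeta5Search.WedgeDictionary

end
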